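import Summits.CriticalPhenomena.CardyFormulaZ2.Theorems.CardyBoundaryCoulombGasRectilinearCardyStubEventIdentityPart7

/-!
# Stub `stub_eventIdentity` of line `excursion-kernel-covariance` (crux `RectilinearCardy`,
# stmt-CriticalPhenomena-5660) — Part 9: the orbit enters the tracked region only at the starts
# `e_B`, `e_X` (CLAIM C / layer L4 of the design `Lines/excursion-kernel-covariance-eventIdentity-design.md`)

Setting of Parts 6–7, `σ = nextCorner (cfgOf ω)`, `ω ⊆ E`.

* `ei_face_of_edge_corners`, `ei_outerFace_not_mem_faces` — face
  bookkeeping: a face with the corners `g`, `g + dir (K+1)` is one of the two faces of that edge; in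
  the radius-`2` frame of a closing junction the outer face at the ghost has no corner in `V`;
* `ei_pred_starts` — the corners `(g_X, K)` and `(g_B, K_B)` just before the starts `e_X`, `e_B`
  are UNTRACKED (outer face) and are mapped to `e_X`, `e_B` by `σ` (their target edge is closed: not
  live, not a spoke, and on no pocket — the only candidate pockets being the outer face and the gap
  face of the junction dart, which is followed by a free stretch);
* `ei_exit_cases` — a tracked corner with untracked successor is a cut, hence `e_A` or `e_C`
  (`e_v'` is followed by the tracked `e_v''`);
* `ei_entry` — **COUNTING**: `σ` is injective, so on the finite tracked set `𝒯` the entries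
  `𝒯 ∖ σ(𝒯)` are as many as the exits `σ(𝒯) ∖ 𝒯`, at most two; they contain `e_B` and `e_X`;
  hence an untracked corner with tracked successor is followed by `e_B` or `e_X`.

All [folklore]; no new objects.
-/

namespace Summit.CriticalPhenomena.CardyFormulaZ2.Cruxes.RectilinearCardy.ExcursionKernelCovariance

open Finset Literature.Probability.LatticeModels Literature.Probability.LatticeModels.CollarLegModel
open Summit.CriticalPhenomena.CardyFormulaZ2.Cruxes.BoundaryDefectGaussianR.RainbowMonomialsInExcursionKernels

/-- **The two faces of an edge.** A face having both `g` and `g + dir (K+1)` among its corners is the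
face `gapFace (g, K)` (on the side of `dir K`) or the face `gapFace (g - dir K, K)`. [folklore] -/
theorem ei_face_of_edge_corners (p g : ℤ × ℤ) (K : Fin 4) (h1 : g ∈ SixVertex.faceCorners p)
    (h2 : g + dir (K + 1) ∈ SixVertex.faceCorners p) : p = gapFace (g, K) ∨ p = gapFace (g - dir K, K) := by
  obtain ⟨a, b⟩ := g
  obtain ⟨x, y⟩ := p
  fin_cases K <;>
    simp [SixVertex.faceCorners, gapFace, dir, Prod.ext_iff] at h1 h2 ⊢ <;> omega

/-- **The outer face at the ghost of a framed dart has no corner in `V`.** In a radius-`2` frame at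
`c` with out-direction `K` (`V = {u ≤ 0}`), the face `gapFace (c + dir K, K)` — corners
`c + dir K`, `c + 2 dir K`, `c + dir K + dir (K+1)`, `c + 2 dir K + dir (K+1)` — is not a face of
`V`. [folklore] -/
theorem ei_outerFace_not_mem_faces {V : Finset (ℤ × ℤ)} {c : ℤ × ℤ} {K : Fin 4}
    (hch : ∀ s u : ℤ, -2 ≤ s → s ≤ 2 → -2 ≤ u → u ≤ 2 → (c + s • dir (K + 1) + u • dir K ∈ V ↔ u ≤ 0)) :
    gapFace (c + dir K, K) ∉ SixVertex.faces V := by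
  intro h
  rw [SixVertex.faces, Finset.mem_biUnion] at h
  obtain ⟨v, hv, hvf⟩ := h
  have hc := se_mem_faceCorners_of_mem_vertexFaces hvf
  rw [mem_faceCorners_gapFace] at hc
  have h01 := (hch 0 1 (by norm_num) (by norm_num) (by norm_num) (by norm_num)).1
  have h02 := (hch 0 2 (by norm_num) (by norm_num) (by norm_num) (by norm_num)).1
  have h11 := (hch 1 1 (by norm_num) (by norm_num) (by norm_num) (by norm_num)).1
  have h12 := (hch 1 2 (by norm_num) (by norm_num) (by norm_num) (by norm_num)).1
  rcases hc with rfl | rfl | rfl | rfl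
  · exact absurd (h01 (by simpa using hv)) (by norm_num)
  · refine absurd (h02 ?_) (by norm_num)
    have : c + dir K + dir K = c + (0 : ℤ) • dir (K + 1) + (2 : ℤ) • dir K := by
      rw [zero_smul, add_zero, two_smul, add_assoc]
    rwa [← this]
  · refine absurd (h11 ?_) (by norm_num)
    have : c + dir K + dir (K + 1) = c + (1 : ℤ) • dir (K + 1) + (1 : ℤ) • dir K := by
      rw [one_smul, one_smul, add_right_comm]
    rwa [← this]
  · refine absurd (h12 ?_) (by norm_num)
    have : c + dir K + dir K + dir (K + 1) = c + (1 : ℤ) • dir (K + 1) + (2 : ℤ) • dir K := by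
      rw [one_smul, two_smul]; abel
    rwa [← this]

section Entry

variable {ι : LegInsertionData} {V : Finset (ℤ × ℤ)} {d₀ : Dart} {iA iB iC : ℕ}
  (hadm : ι.IsAdmissible V)
  (hflat : ∀ x ∈ insert ι.sink ι.source, ∃ dvec : ℤ × ℤ,
      (dvec = (1, 0) ∨ dvec = (-1, 0) ∨ dvec = (0, 1) ∨ dvec = (0, -1)) ∧
      ∀ v : ℤ × ℤ, (v.1 - x.1) ^ 2 + (v.2 - x.2) ^ 2 ≤ ((ι.sinkLegs : ℤ) + 3) ^ 2 →
        (v ∈ V ↔ 0 ≤ (v.1 - x.1) * dvec.1 + (v.2 - x.2) * dvec.2))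
  (hchart : ∀ u ∈ V, ∀ k : Fin 4, u + dir k ∉ V → ∃ (K : Fin 4) (c₁ c₂ : ℤ),
      (∀ v : ℤ × ℤ, |v.1 - u.1| ≤ 3 → |v.2 - u.2| ≤ 3 →
        (v ∈ V ↔ c₂ ≤ v.1 * (dir (K + 1)).1 + v.2 * (dir (K + 1)).2)) ∨
      (∀ v : ℤ × ℤ, |v.1 - u.1| ≤ 3 → |v.2 - u.2| ≤ 3 →
        (v ∈ V ↔ c₁ ≤ v.1 * (dir K).1 + v.2 * (dir K).2 ∧
          c₂ ≤ v.1 * (dir (K + 1)).1 + v.2 * (dir (K + 1)).2)) ∨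
      (∀ v : ℤ × ℤ, |v.1 - u.1| ≤ 3 → |v.2 - u.2| ≤ 3 →
        (v ∈ V ↔ c₂ ≤ v.1 * (dir (K + 1)).1 + v.2 * (dir (K + 1)).2 ∨
          v.1 * (dir K).1 + v.2 * (dir K).2 ≤ c₁)))
  (hv₀ : d₀.1 ∈ V) (ht₀ : dartTip d₀ ∉ V) (hout : outDart V d₀.1 = some d₀)
  (h2 : 2 ≤ iA) (hAB : iA < iB) (hBC : iB < iC) (hCP : iC < period V d₀)
  (hcA : ((neighbours ((dsucc V)^[iA] d₀).1).filter (fun y ↦ y ∉ V)).card = 1)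
  (hcB : ((neighbours ((dsucc V)^[iB] d₀).1).filter (fun y ↦ y ∉ V)).card = 1)
  (hcC : ((neighbours ((dsucc V)^[iC] d₀).1).filter (fun y ↦ y ∉ V)).card = 1)
  (hsrc : ι.source = {((dsucc V)^[iA] d₀).1, ((dsucc V)^[iB] d₀).1, ((dsucc V)^[iC] d₀).1})
  (hlegs : ∀ x ∈ ι.source, ι.legs x = 1) (hsink : ι.sink = d₀.1) (hsl : ι.sinkLegs = 3)

include hadm hflat hchart hv₀ ht₀ hout h2 hAB hBC hCP hcA hcB hcC hsrc hlegs hsink hsl in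
/-- **The corner before a start is untracked and turns into the start.** At a closing junction dart
`(c, K)` (the sink's dart, or the dart `iB`), with ghost `g = c + dir K`: the corner `(g, K)` lies in
the outer face (no corner in `V`: untracked), and its target edge `{g, g + dir (K+1)}` is closed in
`cfgOf ω` (not live; not a spoke; the faces containing it are the outer face — not a face of `V` —
and the gap face of the dart — met on a free stretch, hence no pocket, gap faces determining their
darts), so the turning rule rotates it onto the start `(g, K+1)`. [folklore] -/
theorem ei_pred_starts {ω : Finset ((ℤ × ℤ) × Bool)} (hω : ω ⊆ (ι.model V).E) :
    (¬(ι.model V).IsTracked (toSite (dartTip d₀), d₀.2) ∧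
      nextCorner ((ι.model V).cfgOf ω) (toSite (dartTip d₀), d₀.2) = (toSite (dartTip d₀), d₀.2 + 1)) ∧
    (¬(ι.model V).IsTracked (toSite (dartTip ((dsucc V)^[iB] d₀)), ((dsucc V)^[iB] d₀).2) ∧
      nextCorner ((ι.model V).cfgOf ω) (toSite (dartTip ((dsucc V)^[iB] d₀)), ((dsucc V)^[iB] d₀).2) = (toSite (dartTip ((dsucc V)^[iB] d₀)), ((dsucc V)^[iB] d₀).2 + 1)) := by
  obtain ⟨hs0, hs1, -, -, -, hsB, hsB1, -⟩ := ei_states hv₀ ht₀ hout h2 hAB hBC hCP hcA hcB hcC hsrc hlegs hsink hsl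
  have h0 : outDart V ι.sink = some d₀ := by rw [hsink]; exact hout
  have hst : ∀ t, (fun t => List.foldl (fun s d => s.step (ι.startAt V d)) ι.init ((cycle V d₀).take t)) t = List.foldl (fun s d => s.step (ι.startAt V d)) ι.init ((cycle V d₀).take t) := fun _ => rfl
  have hget : ∀ (t : ℕ) (ht : t < (cycle V d₀).length), (cycle V d₀)[t] = (dsucc V)^[t] d₀ := by
    intro t ht; simp [cycle]
  have hext : ∀ i, ((dsucc V)^[i] d₀).1 ∈ V ∧ dartTip ((dsucc V)^[i] d₀) ∉ V :=
    fun i => (s3_dsucc_iterate V i).1 d₀ hv₀ ht₀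
  have hnp := tc_noPinch_of_chart hchart
  have harcV : (ι.model V).arcVerts ⊆ V := Finset.inter_subset_right
  -- the generic argument at a closing-junction dart `t` with frame `hch` and free state after it
  have key : ∀ (t : ℕ) (ht : t < (cycle V d₀).length),
      (∀ s u : ℤ, -2 ≤ s → s ≤ 2 → -2 ≤ u → u ≤ 2 →
        (((dsucc V)^[t] d₀).1 + s • dir (((dsucc V)^[t] d₀).2 + 1) + u • dir ((dsucc V)^[t] d₀).2 ∈ V ↔
          u ≤ 0)) →
      (List.foldl (fun s d => s.step (ι.startAt V d)) ι.init ((cycle V d₀).take (t + 1))).wired = false →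
      ¬(ι.model V).IsTracked (toSite (dartTip ((dsucc V)^[t] d₀)), ((dsucc V)^[t] d₀).2) ∧
        nextCorner ((ι.model V).cfgOf ω) (toSite (dartTip ((dsucc V)^[t] d₀)), ((dsucc V)^[t] d₀).2) =
          (toSite (dartTip ((dsucc V)^[t] d₀)), ((dsucc V)^[t] d₀).2 + 1) := by
    intro t ht hch hfree
    set c := ((dsucc V)^[t] d₀).1 with hc
    set K := ((dsucc V)^[t] d₀).2 with hK
    have hg : dartTip ((dsucc V)^[t] d₀) = c + dir K := rfl
    rw [hg]
    have hout' := ei_outerFace_not_mem_faces hch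
    have h11 := (hch 1 1 (by norm_num) (by norm_num) (by norm_num) (by norm_num)).1
    have hg1 : c + dir K + dir (K + 1) ∉ V := fun hv => absurd (h11 (by
      rwa [one_smul, one_smul, add_right_comm])) (by norm_num)
    have hgV : c + dir K ∉ V := hext t |>.2
    constructor
    · -- untracked: its face is the outer face
      rintro ⟨-, hf⟩
      apply hout'
      have : ofSite (cFace (toSite (c + dir K), K)) = gapFace (c + dir K, K) := by
        rw [ei_gapFace_site]; rfl
      rw [this] at hf
      exact hf
    · -- the target edge is closed
      apply nextCorner_of_not_mem
      intro hb
      obtain ⟨e, hce, hend⟩ := se_corner_edge (c + dir K) K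
      rcases (se_cTgt_mem_cfgOf_iff (ι.model V) ω hce).1 hb with he | he
      · have hE := hω he
        rw [E, inducedEdges, mem_filter] at hE
        rcases hend with ⟨h1, -⟩ | ⟨h1, -⟩
        · exact hgV (h1 ▸ hE.2.1)
        · exact hg1 (h1 ▸ hE.2.1)
      · have he' := he
        rw [openEdges, mem_filter] at he'
        rcases he'.2 with ⟨ha, -⟩ | ⟨ha, -⟩ | ⟨-, -, p, hp, hep⟩
        · rcases hend with ⟨h1, -⟩ | ⟨h1, -⟩
          · exact hgV (h1 ▸ harcV ha)
          · exact hg1 (h1 ▸ harcV ha)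
        · rcases hend with ⟨-, h2⟩ | ⟨-, h2⟩
          · exact hg1 (h2 ▸ harcV ha)
          · exact hgV (h2 ▸ harcV ha)
        · -- a pocket containing the edge: the outer face or the gap face of the dart
          obtain ⟨hc1, hc2⟩ := endpoints_mem_faceCorners_of_mem_faceEdges hep
          have hcor : c + dir K ∈ SixVertex.faceCorners p ∧ c + dir K + dir (K + 1) ∈ SixVertex.faceCorners p := by
            rcases hend with ⟨h1, h2⟩ | ⟨h1, h2⟩
            · exact ⟨h1 ▸ hc1, h2 ▸ hc2⟩
            · exact ⟨h2 ▸ hc2, h1 ▸ hc1⟩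
          obtain ⟨hpC, hpB⟩ := Finset.mem_inter.1 hp
          rcases ei_face_of_edge_corners p (c + dir K) K hcor.1 hcor.2 with rfl | rfl
          · exact hout' (Finset.mem_filter.1 hpB).1
          · rw [add_sub_cancel_right] at hpC hpB
            obtain ⟨t', ht', hw', hgap⟩ := (mem_collar_pocket_iff ι V h0 hst).1 hpC
            have hext' := cycle_getElem_exterior ι V hadm h0 ht'
            have hdd : (cycle V d₀)[t'] = (c, K) :=
              tc_gapFace_inj hnp (d := (c, K)) (hext t).1 (hext t).2 hext'.1 hext'.2 hgap
            rw [hget t' ht'] at hdd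
            have htt : t' = t := by
              refine sm_iter_inj hv₀ ht₀ (by simpa [cycle] using ht') (by simpa [cycle] using ht) ?_
              rw [hdd]
            subst htt
            rw [hfree] at hw'
            exact Bool.false_ne_true hw'
  -- the sink's dart `t = 0`
  obtain ⟨hl0, hch0, -⟩ := ei_rail hadm hflat hout hsink (t := 0) (by omega) (by rw [hs1, hs0]; decide)
  -- the dart `iB`
  obtain ⟨hlB, hchB, -⟩ := ei_rail hadm hflat hout hsink (t := iB) (by omega) (by rw [hsB1, hsB]; decide)
  exact ⟨key 0 hl0 hch0 (by rw [hs1]), key iB hlB hchB (by rw [hsB1])⟩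

include hadm hflat hchart hv₀ ht₀ hout h2 hAB hBC hCP hcA hcB hcC hsrc hlegs hsink hsl in
/-- **Exits**: a tracked corner whose successor is untracked is a cut, hence `e_A` or `e_C`.
[folklore] -/
theorem ei_exit_cases {ω : Finset ((ℤ × ℤ) × Bool)} (hω : ω ⊆ (ι.model V).E) {c : Site 2 × Fin 4}
    (htr : (ι.model V).IsTracked c) (hn : ¬(ι.model V).IsTracked (nextCorner ((ι.model V).cfgOf ω) c)) :
    c = (toSite (dartTip ((dsucc V)^[iA] d₀)), ((dsucc V)^[iA] d₀).2 + 2) ∨ c = (toSite (dartTip ((dsucc V)^[iC] d₀)), ((dsucc V)^[iC] d₀).2 + 2) := by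
  have hcut : (ι.model V).IsCut c := by
    by_contra h
    exact hn (dict_isTracked_nextCorner_of_not_isCut hω h)
  obtain ⟨-, -, htr2, -⟩ := ei_ends_tracked hadm hflat hv₀ ht₀ hout h2 hAB hBC hCP hcA hcB hcC hsrc hlegs hsink hsl
  obtain ⟨-, ⟨-, h1n⟩, -⟩ := ei_start_pred hadm hflat hv₀ ht₀ hout h2 hAB hBC hCP hcA hcB hcC hsrc hlegs hsink hsl hω
  rcases ei_trackedCut_cases hadm hflat hchart hv₀ ht₀ hout h2 hAB hBC hCP hcA hcB hcC hsrc hlegs hsink hsl htr hcut with rfl | h | h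
  · rw [h1n] at hn; exact absurd htr2 hn
  · exact Or.inl h
  · exact Or.inr h

include hadm hflat hchart hv₀ ht₀ hout h2 hAB hBC hCP hcA hcB hcC hsrc hlegs hsink hsl in
/-- **Entries (CLAIM C).** An untracked corner whose successor is tracked is followed by the start
`e_B` or the start `e_X`: the turning rule is injective, so on the finite tracked set the entries
are as many as the exits — at most two — and `e_B`, `e_X` are entries. [folklore] -/
theorem ei_entry {ω : Finset ((ℤ × ℤ) × Bool)} (hω : ω ⊆ (ι.model V).E) {c : Site 2 × Fin 4}
    (hc : ¬(ι.model V).IsTracked c) (htr : (ι.model V).IsTracked (nextCorner ((ι.model V).cfgOf ω) c)) :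
    nextCorner ((ι.model V).cfgOf ω) c = (toSite (dartTip ((dsucc V)^[iB] d₀)), ((dsucc V)^[iB] d₀).2 + 1) ∨ nextCorner ((ι.model V).cfgOf ω) c = (toSite (dartTip d₀), d₀.2 + 1) := by
  classical
  obtain ⟨htrX, -, -, -, htrB, -⟩ := ei_ends_tracked hadm hflat hv₀ ht₀ hout h2 hAB hBC hCP hcA hcB hcC hsrc hlegs hsink hsl
  obtain ⟨⟨hnX, hσX⟩, ⟨hnB, hσB⟩⟩ := ei_pred_starts hadm hflat hchart hv₀ ht₀ hout h2 hAB hBC hCP hcA hcB hcC hsrc hlegs hsink hsl hω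
  set σ := nextCorner ((ι.model V).cfgOf ω) with hσ
  have hinj : Function.Injective σ := nextCorner_injective
  -- the tracked set
  set T : Finset (Site 2 × Fin 4) :=
    (((ι.model V).vertexCells.image toSite) ×ˢ (Finset.univ : Finset (Fin 4))).filter (fun q => (ι.model V).IsTracked q)
    with hT
  have hmemT : ∀ q, q ∈ T ↔ (ι.model V).IsTracked q := by
    intro q
    simp only [hT, Finset.mem_filter, Finset.mem_product, Finset.mem_image, Finset.mem_univ, and_true]
    constructor
    · exact And.right
    · intro h
      refine ⟨⟨ofSite q.1, h.1, ?_⟩, h⟩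
      have := congrArg Prod.fst (ei_corner_eq q)
      exact this.symm
  set I := T.image σ with hI
  -- exits: `I \ T ⊆ {σ e_A, σ e_C}`
  have hexit : I \ T ⊆ {σ (toSite (dartTip ((dsucc V)^[iA] d₀)), ((dsucc V)^[iA] d₀).2 + 2), σ (toSite (dartTip ((dsucc V)^[iC] d₀)), ((dsucc V)^[iC] d₀).2 + 2)} := by
    intro d hd
    rw [Finset.mem_sdiff] at hd
    obtain ⟨q, hq, rfl⟩ := Finset.mem_image.1 hd.1
    rcases ei_exit_cases hadm hflat hchart hv₀ ht₀ hout h2 hAB hBC hCP hcA hcB hcC hsrc hlegs hsink hsl hω ((hmemT q).1 hq)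
      (fun h => hd.2 ((hmemT _).2 h)) with rfl | rfl
    · exact Finset.mem_insert_self _ _
    · exact Finset.mem_insert_of_mem (Finset.mem_singleton_self _)
  have hcard1 : (I \ T).card ≤ 2 := (Finset.card_le_card hexit).trans Finset.card_le_two
  -- as many entries as exits
  have hcard2 : (T \ I).card = (I \ T).card := by
    have h1 := Finset.card_sdiff_add_card_inter T I
    have h2 := Finset.card_sdiff_add_card_inter I T
    have h3 : I.card = T.card := Finset.card_image_of_injective _ hinj
    rw [Finset.inter_comm] at h2
    omega
  -- an untracked predecessor makes an entry
  have hentry : ∀ {q d : Site 2 × Fin 4}, ¬(ι.model V).IsTracked q → σ q = d → (ι.model V).IsTracked d → d ∈ T \ I := by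
    intro q d hq hqd hd
    rw [Finset.mem_sdiff]
    refine ⟨(hmemT d).2 hd, fun hdI => ?_⟩
    obtain ⟨q', hq', hq'd⟩ := Finset.mem_image.1 hdI
    have := hinj (hq'd.trans hqd.symm)
    subst this
    exact hq ((hmemT _).1 hq')
  -- `e_B ≠ e_X`
  have hBX : (toSite (dartTip ((dsucc V)^[iB] d₀)), ((dsucc V)^[iB] d₀).2 + 1) ≠ (toSite (dartTip d₀), d₀.2 + 1) := by
    intro h
    obtain ⟨h1, h2⟩ := Prod.ext_iff.1 h
    simp only [toSite_inj] at h1 h2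
    have hK : ((dsucc V)^[iB] d₀).2 = d₀.2 := add_right_cancel h2
    rw [dartTip, dartTip, hK] at h1
    have hv : ((dsucc V)^[iB] d₀).1 = d₀.1 := add_right_cancel h1
    have hd : (dsucc V)^[iB] d₀ = (dsucc V)^[0] d₀ := Prod.ext hv hK
    have := sm_iter_inj hv₀ ht₀ (by omega) (by omega) hd
    omega
  have hsub : ({(toSite (dartTip ((dsucc V)^[iB] d₀)), ((dsucc V)^[iB] d₀).2 + 1), (toSite (dartTip d₀), d₀.2 + 1)} : Finset (Site 2 × Fin 4)) ⊆ T \ I := by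
    intro d hd
    simp only [Finset.mem_insert, Finset.mem_singleton] at hd
    rcases hd with rfl | rfl
    · exact hentry hnB hσB htrB
    · exact hentry hnX hσX htrX
  have hEq : ({(toSite (dartTip ((dsucc V)^[iB] d₀)), ((dsucc V)^[iB] d₀).2 + 1), (toSite (dartTip d₀), d₀.2 + 1)} : Finset (Site 2 × Fin 4)) = T \ I :=
    Finset.eq_of_subset_of_card_le hsub (by rw [hcard2, Finset.card_pair hBX]; exact hcard1)
  have hd : σ c ∈ T \ I := hentry hc rfl htr
  rw [← hEq] at hd
  simpa only [Finset.mem_insert, Finset.mem_singleton] using hd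

end Entry

/-- **Registered form of `ei_entry`** (landing anchor, all hypotheses explicit): an untracked
corner whose successor under the turning rule of `cfgOf ω` is tracked is followed by `e_B` or `e_X`.
[folklore] -/
theorem ei_entry_explicit {ι : LegInsertionData} {V : Finset (ℤ × ℤ)} {d₀ : Dart} {iA iB iC : ℕ}
    (hadm : ι.IsAdmissible V)
    (hflat : ∀ x ∈ insert ι.sink ι.source, ∃ dvec : ℤ × ℤ,
      (dvec = (1, 0) ∨ dvec = (-1, 0) ∨ dvec = (0, 1) ∨ dvec = (0, -1)) ∧
      ∀ v : ℤ × ℤ, (v.1 - x.1) ^ 2 + (v.2 - x.2) ^ 2 ≤ ((ι.sinkLegs : ℤ) + 3) ^ 2 →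
        (v ∈ V ↔ 0 ≤ (v.1 - x.1) * dvec.1 + (v.2 - x.2) * dvec.2))
    (hchart : ∀ u ∈ V, ∀ k : Fin 4, u + dir k ∉ V → ∃ (K : Fin 4) (c₁ c₂ : ℤ),
      (∀ v : ℤ × ℤ, |v.1 - u.1| ≤ 3 → |v.2 - u.2| ≤ 3 →
        (v ∈ V ↔ c₂ ≤ v.1 * (dir (K + 1)).1 + v.2 * (dir (K + 1)).2)) ∨
      (∀ v : ℤ × ℤ, |v.1 - u.1| ≤ 3 → |v.2 - u.2| ≤ 3 →
        (v ∈ V ↔ c₁ ≤ v.1 * (dir K).1 + v.2 * (dir K).2 ∧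
          c₂ ≤ v.1 * (dir (K + 1)).1 + v.2 * (dir (K + 1)).2)) ∨
      (∀ v : ℤ × ℤ, |v.1 - u.1| ≤ 3 → |v.2 - u.2| ≤ 3 →
        (v ∈ V ↔ c₂ ≤ v.1 * (dir (K + 1)).1 + v.2 * (dir (K + 1)).2 ∨
          v.1 * (dir K).1 + v.2 * (dir K).2 ≤ c₁)))
    (hv₀ : d₀.1 ∈ V) (ht₀ : dartTip d₀ ∉ V) (hout : outDart V d₀.1 = some d₀)
  (h2 : 2 ≤ iA) (hAB : iA < iB) (hBC : iB < iC) (hCP : iC < period V d₀)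
  (hcA : ((neighbours ((dsucc V)^[iA] d₀).1).filter (fun y ↦ y ∉ V)).card = 1)
  (hcB : ((neighbours ((dsucc V)^[iB] d₀).1).filter (fun y ↦ y ∉ V)).card = 1)
  (hcC : ((neighbours ((dsucc V)^[iC] d₀).1).filter (fun y ↦ y ∉ V)).card = 1)
  (hsrc : ι.source = {((dsucc V)^[iA] d₀).1, ((dsucc V)^[iB] d₀).1, ((dsucc V)^[iC] d₀).1})
  (hlegs : ∀ x ∈ ι.source, ι.legs x = 1) (hsink : ι.sink = d₀.1) (hsl : ι.sinkLegs = 3) {ω : Finset ((ℤ × ℤ) × Bool)} (hω : ω ⊆ (ι.model V).E)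
    {c : Site 2 × Fin 4} (hc : ¬(ι.model V).IsTracked c) (htr : (ι.model V).IsTracked (nextCorner ((ι.model V).cfgOf ω) c)) :
    nextCorner ((ι.model V).cfgOf ω) c = (toSite (dartTip ((dsucc V)^[iB] d₀)), ((dsucc V)^[iB] d₀).2 + 1) ∨ nextCorner ((ι.model V).cfgOf ω) c = (toSite (dartTip d₀), d₀.2 + 1) :=
  ei_entry hadm hflat hchart hv₀ ht₀ hout h2 hAB hBC hCP hcA hcB hcC hsrc hlegs hsink hsl hω hc htr

end Summit.CriticalPhenomena.CardyFormulaZ2.Cruxes.RectilinearCardy.ExcursionKernelCovariance
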